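import Literature.AlgebraicGeometry.HodgeTheory.VHSDataSubHodgeStructureTranslateLocus
import Literature.AlgebraicGeometry.Motives.FamiliesVHSExteriorPower
import HarnessLib

/-!
# Cattani–Deligne–Kaplan, Corollary 1.4 for a rational subspace of ANY dimension over a punctured compact curve: «one applies 1.3» to the
# exterior-power variation `⋀ᵈ 𝒱`

Topic `Literature/AlgebraicGeometry/HodgeTheory` (namespace `Literature.AlgebraicGeometry.Motives.VHSData`), lane `lit-hodgefound` (seat `p08`, row
g55-#11).  THEOREMS ONLY (no definition, no named fact, no instance; D-0026 net debt `0`).  Junction of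
`HodgeTheory/VHSDataSubHodgeStructureTranslateLocus` (Cor. 1.4 pointwise for every `d`: the locus `T(U)` of a `d`-dimensional rational `U ⊆ V_s` is
`{t | ∃ γ : s ⇝ t, ⋀ᵈ(γ·)(u₁ ∧ ⋯ ∧ u_d) ∈ Hdg^P(⋀ᵈ V_t)}`) with `Motives/FamiliesVHSExteriorPower` (the exterior-power datum `⋀ᵈ D : VHSData S (d·k)`,
`toRat(m₁ ∧ ⋯ ∧ m_d) = toRat m₁ ∧ ⋯ ∧ toRat m_d`) and the tree's one-variable Cor. 1.3 (`determinationLocus_eq_univ_or_finite_of_compactification`).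

PRINTED SOURCE, VERBATIM (E. Cattani, P. Deligne, A. Kaplan, *On the locus of Hodge classes*, J. AMS 8 (1995), p. 486; held text
`paper:arxiv-alg-geom_9402009` p0002): «**Corollary 1.4.** Fix `s ∈ S` and `U_ℚ ⊂ 𝒱_ℚ,s` a rational subspace.  The set of `t ∈ S`, such that some flat
translate of `U_ℚ` to `𝒱_ℚ,t` is a Hodge substructure, is an algebraic subvariety of `S`.  *Proof.* If `U_ℚ` is one-dimensional: … Let `e` be a
generator of `U_ℚ ∩ 𝒱_ℤ`. Then `U_ℚ` is a Hodge substructure if and only if `e` is of type `(0,0)`, and one applies 1.3.  Consider now the general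
case: `U` of dimension `n`. … This amounts to `⋀ⁿ U_ℝ ⊂ ⋀ⁿ H_ℝ` being stable under `ℂ*`, i.e., to `⋀ⁿ U_ℚ` being a Hodge substructure of `⋀ⁿ H_ℚ`,
and reduces us to the one-dimensional case, proving 1.4.»  For a curve (`dim S = 1`) «algebraic subvariety» = all of `S` or a finite set.

* §1 **integral frames**: every rational vector has a nonzero integral multiple in `V_ℤ,s` (`exists_int_smul_mem_range_toRat`, `exists_int_smul_eq_toRat`), so a `d`-dimensional rational
  `U ⊆ V_s` has a basis `toRat m₁, …, toRat m_d` of images of INTEGRAL vectors (`exists_integral_frame`) — `e = m₁ ∧ ⋯ ∧ m_d ∈ ⋀ᵈ V_ℤ,s` is then an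
  integral vector on the line `⋀ᵈ U` («a generator of `⋀ᵈU_ℚ ∩ ⋀ᵈ𝒱_ℤ`» up to index).
* §2 **`exists_subHodgeStructure_translate_iff_isHodgeAt_exteriorPower`** — pointwise: `γ · U` underlies a sub-Hodge structure of `V_t` iff the
  determination `γ · (m₁ ∧ ⋯ ∧ m_d)` in `⋀ᵈ D` is of type `(P, P)` (`2P = d·k`); **`translateLocus_eq_determinationLocus_exteriorPower`** — `T(U)` IS
  the determination locus (Cor. 1.3's set) of `m₁ ∧ ⋯ ∧ m_d` for `⋀ᵈ D`.
* §3 **`translateLocus_eq_univ_or_finite_of_compactification`** — COR. 1.4, `dim U = d` arbitrary, `r = 1`, over a PUNCTURED COMPACT CURVE: with the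
  period charts of the tree's Cor. 1.3 FOR `⋀ᵈ D` and the compactification with disc charts at the punctures, **`T(U)` is ALL of `S` or FINITE**;
  `translateLocus_eq_univ_or_finite` — the same with abstract open ends ∕ compact core; `forall_exists_subHodgeStructure_translate_of_infinite` — an
  infinite locus is everything.

NOT HERE: the several-variables theorem (`dim S ≥ 2`); deriving the period charts of `⋀ᵈ D` from those of `D` (functoriality of nilpotent orbits and of
limit mixed Hodge structures under `⋀ᵈ`, Schmid 1973 ∕ CKS 1986) — they are hypotheses here, exactly as for `D` in the tree's Cor. 1.3.

## References

* [CattaniDeligneKaplan1995] E. Cattani, P. Deligne, A. Kaplan, *On the locus of Hodge classes*, J. Amer. Math. Soc. 8 (1995) 483–506: Cor. 1.3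
  (p. 484), Cor. 1.4 and its proof (p. 486), «Proof of 1.5 ⟹ 1.1» (p. 485).
* [Schmid1973] W. Schmid, *Variation of Hodge structure: the singularities of the period mapping*, Invent. Math. 22 (1973): §2 (`H_ℚ = H_ℤ ⊗ ℚ`).
-/

noncomputable section

open scoped TensorProduct ComplexOrder
open _root_.Topology _root_.Filter Set

namespace Literature.AlgebraicGeometry

open Module
open Motives Motives.MixedHodgeStructure Motives.HodgeStructure
open Motives.HodgeStructure (conj ofRat ofRat_apply conj_ofRat)
open HodgeTheory

universe u

namespace Motives.VHSData

variable {S : Type} [TopologicalSpace S] {k : ℤ} (D : VHSData S k)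

/-! ## §1 Integral frames of rational subspaces -/

/-- **Every rational vector has a nonzero integral multiple which is integral**: for `v ∈ V_s` there is `N ≠ 0` with `N · v` in the image of
`toRat : V_ℤ,s → V_s` (`V_s = V_ℤ,s ⊗ ℚ`; Schmid 1973 §2: «`H_ℚ = H_ℤ ⊗ ℚ`»; induction over the tensor product, clearing denominators).
[cite: Schmid1973, §2] -/
theorem exists_int_smul_mem_range_toRat (s : S) (v : D.V.fiber s) : ∃ N : ℤ, N ≠ 0 ∧ (N : ℚ) • v ∈ (D.toRat s).range := by
  let e : D.V.fiber s ≃ₗ[ℚ] ℚ ⊗[ℤ] (D.VZ.fiber s) := (D.ratIso.app ⟨s⟩).toLinearEquiv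
  have he : ∀ m : D.VZ.fiber s, e.symm ((1 : ℚ) ⊗ₜ[ℤ] m) = D.toRat s m := fun m => rfl
  suffices H : ∀ x : ℚ ⊗[ℤ] (D.VZ.fiber s), ∃ N : ℤ, N ≠ 0 ∧ (N : ℚ) • e.symm x ∈ (D.toRat s).range by
    simpa only [e.symm_apply_apply] using H (e v)
  intro x
  induction x using TensorProduct.induction_on with
  | zero => exact ⟨1, one_ne_zero, by rw [map_zero, smul_zero]; exact zero_mem _⟩
  | tmul q m =>
    -- `den(q) · (q ⊗ m) = num(q) ⊗ m = num(q) · toRat m`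
    refine ⟨(q.den : ℤ), by exact_mod_cast q.den_ne_zero, ?_⟩
    have hq : ((q.num : ℚ) ⊗ₜ[ℤ] m : ℚ ⊗[ℤ] (D.VZ.fiber s)) = (q.num : ℚ) • ((1 : ℚ) ⊗ₜ[ℤ] m) := by
      rw [TensorProduct.smul_tmul', smul_eq_mul, mul_one]
    rw [← map_smul, TensorProduct.smul_tmul', smul_eq_mul, Int.cast_natCast, Rat.den_mul_eq_num, hq, map_smul, he, Int.cast_smul_eq_zsmul]
    exact AddSubgroup.zsmul_mem _ (AddMonoidHom.mem_range.mpr ⟨m, rfl⟩) _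
  | add x y hx hy =>
    obtain ⟨N₁, hN₁, h₁⟩ := hx
    obtain ⟨N₂, hN₂, h₂⟩ := hy
    refine ⟨N₁ * N₂, mul_ne_zero hN₁ hN₂, ?_⟩
    have h₁' : (N₂ : ℚ) • ((N₁ : ℚ) • e.symm x) ∈ (D.toRat s).range := by
      rw [Int.cast_smul_eq_zsmul ℚ N₂ ((N₁ : ℚ) • e.symm x)]; exact AddSubgroup.zsmul_mem _ h₁ N₂
    have h₂' : (N₁ : ℚ) • ((N₂ : ℚ) • e.symm y) ∈ (D.toRat s).range := by
      rw [Int.cast_smul_eq_zsmul ℚ N₁ ((N₂ : ℚ) • e.symm y)]; exact AddSubgroup.zsmul_mem _ h₂ N₁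
    rw [map_add, smul_add, Int.cast_mul, mul_comm (N₁ : ℚ), mul_smul, mul_comm (N₂ : ℚ), mul_smul]
    exact add_mem h₁' h₂'

/-- For `v ∈ V_s` there are `N ≠ 0` and `m ∈ V_ℤ,s` with `N · v = toRat m`. [cite: Schmid1973, §2] -/
theorem exists_int_smul_eq_toRat (s : S) (v : D.V.fiber s) : ∃ N : ℤ, N ≠ 0 ∧ ∃ m : D.VZ.fiber s, (N : ℚ) • v = D.toRat s m := by
  obtain ⟨N, hN, h⟩ := D.exists_int_smul_mem_range_toRat s v
  obtain ⟨m, hm⟩ := AddMonoidHom.mem_range.mp h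
  exact ⟨N, hN, m, hm.symm⟩

/-- **Integral frames**: a `d`-dimensional rational subspace `U ⊆ V_s` contains a linearly independent family `toRat m₁, …, toRat m_d` of images of
INTEGRAL vectors `mᵢ ∈ V_ℤ,s` (hence a basis of `U`; «let `e` be a generator of `U_ℚ ∩ 𝒱_ℤ`», `d = 1`). [cite: CattaniDeligneKaplan1995, proof of Cor. 1.4 (p. 486)] -/
theorem exists_integral_frame (s : S) {U : Submodule ℚ (D.V.fiber s)} {d : ℕ} (hd : Module.finrank ℚ U = d) :
    ∃ m : Fin d → D.VZ.fiber s, LinearIndependent ℚ (fun i => D.toRat s (m i)) ∧ ∀ i, D.toRat s (m i) ∈ U := by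
  haveI : Module.Finite ℚ (D.V.fiber s) := D.finite_fiber s
  let b := Module.finBasisOfFinrankEq ℚ U hd
  choose N hN m hm using fun i => D.exists_int_smul_eq_toRat s (b i : D.V.fiber s)
  refine ⟨m, ?_, fun i => ?_⟩
  · have hb : LinearIndependent ℚ (fun i => (b i : D.V.fiber s)) := b.linearIndependent.map' U.subtype (Submodule.ker_subtype U)
    have hb' := hb.units_smul fun i => Units.mk0 (N i : ℚ) (Int.cast_ne_zero.mpr (hN i))
    convert hb' using 1
    funext i
    rw [← hm i, Pi.smul_apply', Units.smul_mk0]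
  · rw [← hm i]
    exact U.smul_mem _ (b i).2

/-! ## §2 The translate locus of `U` is the determination locus of `m₁ ∧ ⋯ ∧ m_d` in `⋀ᵈ D` -/

/-- **Cor. 1.4 pointwise through `⋀ᵈ D`**: for integral `m₁, …, m_d ∈ V_ℤ,s` with `toRat m₁, …, toRat m_d` linearly independent, `P + P = d·k` and
`γ : s ⇝ t`: **`γ · span(toRat mᵢ)` underlies a sub-Hodge structure of `V_t` iff the determination `γ · (m₁ ∧ ⋯ ∧ m_d)` in `⋀ᵈ D` is of type
`(P, P)`** («`U_ℚ` is a Hodge substructure if and only if `e` is of type `(0,0)`» ∕ «`⋀ⁿ U_ℚ` being a Hodge substructure of `⋀ⁿ H_ℚ` … reduces us to the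
one-dimensional case»). [cite: CattaniDeligneKaplan1995, proof of Cor. 1.4 (p. 486)] -/
theorem exists_subHodgeStructure_translate_iff_isHodgeAt_exteriorPower {s t : S} (γ : Path.Homotopic.Quotient s t) {d : ℕ}
    {m : Fin d → D.VZ.fiber s} (hu : LinearIndependent ℚ (fun i => D.toRat s (m i))) {P : ℤ} (hP : P + P = d * k) :
    (∃ W : SubHodgeStructure (D.hodge t), W.toSubmodule = (Submodule.span ℚ (Set.range fun i => D.toRat s (m i))).map (D.V.transport γ)) ↔
      (D.exteriorPower d).IsHodgeAt t P ((D.exteriorPower d).VZ.transport γ (_root_.exteriorPower.ιMulti ℤ d m)) := by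
  haveI : ∀ s : S, Module.Finite ℚ (D.V.fiber s) := fun s => D.finite_fiber s
  rw [D.exists_subHodgeStructure_translate_iff γ hu hP, D.isHodgeAt_exteriorPower_transport_ιMulti_iff d γ P m]

/-- The same for a given `U ⊆ V_s` of dimension `d` containing the frame. [cite: CattaniDeligneKaplan1995, proof of Cor. 1.4 (p. 486)] -/
theorem exists_subHodgeStructure_translate_iff_isHodgeAt_exteriorPower_of_finrank_eq {s t : S} (γ : Path.Homotopic.Quotient s t)
    {U : Submodule ℚ (D.V.fiber s)} {d : ℕ} {m : Fin d → D.VZ.fiber s} (hu : LinearIndependent ℚ (fun i => D.toRat s (m i)))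
    (hmU : ∀ i, D.toRat s (m i) ∈ U) (hd : Module.finrank ℚ U = d) {P : ℤ} (hP : P + P = d * k) :
    (∃ W : SubHodgeStructure (D.hodge t), W.toSubmodule = U.map (D.V.transport γ)) ↔
      (D.exteriorPower d).IsHodgeAt t P ((D.exteriorPower d).VZ.transport γ (_root_.exteriorPower.ιMulti ℤ d m)) := by
  haveI : ∀ s : S, Module.Finite ℚ (D.V.fiber s) := fun s => D.finite_fiber s
  rw [D.exists_subHodgeStructure_translate_iff_of_finrank_eq γ hu hmU hd hP, D.isHodgeAt_exteriorPower_transport_ιMulti_iff d γ P m]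

/-- **«Reduces us to the one-dimensional case»: the Cor-1.4 locus `T(span(toRat mᵢ))` IS the determination locus (Cor. 1.3's set) of the integral
vector `m₁ ∧ ⋯ ∧ m_d` of `⋀ᵈ D`.** [cite: CattaniDeligneKaplan1995, proof of Cor. 1.4 (p. 486) and Cor. 1.3 (p. 484)] -/
theorem translateLocus_eq_determinationLocus_exteriorPower (s : S) {d : ℕ} {m : Fin d → D.VZ.fiber s}
    (hu : LinearIndependent ℚ (fun i => D.toRat s (m i))) {P : ℤ} (hP : P + P = d * k) :
    {t : S | ∃ γ : Path.Homotopic.Quotient s t, ∃ W : SubHodgeStructure (D.hodge t),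
        W.toSubmodule = (Submodule.span ℚ (Set.range fun i => D.toRat s (m i))).map (D.V.transport γ)} =
      {t : S | ∃ γ : Path.Homotopic.Quotient s t,
        (D.exteriorPower d).IsHodgeAt t P ((D.exteriorPower d).VZ.transport γ (_root_.exteriorPower.ιMulti ℤ d m))} := by
  ext t
  exact exists_congr fun γ => D.exists_subHodgeStructure_translate_iff_isHodgeAt_exteriorPower γ hu hP

/-- The locus of a given `d`-dimensional `U` containing the frame: `T(U)` is the determination locus of `m₁ ∧ ⋯ ∧ m_d` in `⋀ᵈ D`.
[cite: CattaniDeligneKaplan1995, proof of Cor. 1.4 (p. 486) and Cor. 1.3 (p. 484)] -/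
theorem translateLocus_eq_determinationLocus_exteriorPower_of_finrank_eq (s : S) {U : Submodule ℚ (D.V.fiber s)} {d : ℕ}
    {m : Fin d → D.VZ.fiber s} (hu : LinearIndependent ℚ (fun i => D.toRat s (m i))) (hmU : ∀ i, D.toRat s (m i) ∈ U)
    (hd : Module.finrank ℚ U = d) {P : ℤ} (hP : P + P = d * k) :
    {t : S | ∃ γ : Path.Homotopic.Quotient s t, ∃ W : SubHodgeStructure (D.hodge t), W.toSubmodule = U.map (D.V.transport γ)} =
      {t : S | ∃ γ : Path.Homotopic.Quotient s t,
        (D.exteriorPower d).IsHodgeAt t P ((D.exteriorPower d).VZ.transport γ (_root_.exteriorPower.ιMulti ℤ d m))} := by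
  ext t
  exact exists_congr fun γ => D.exists_subHodgeStructure_translate_iff_isHodgeAt_exteriorPower_of_finrank_eq γ hu hmU hd hP

/-- **Every `d`-dimensional rational `U ⊆ V_s` has an integral `d`-vector `e = m₁ ∧ ⋯ ∧ m_d ∈ ⋀ᵈ V_ℤ,s` whose determination locus in `⋀ᵈ D` is the
Cor-1.4 locus of `U`** (`2P = d·k`). [cite: CattaniDeligneKaplan1995, proof of Cor. 1.4 (p. 486)] -/
theorem exists_translateLocus_eq_determinationLocus_exteriorPower (s : S) (U : Submodule ℚ (D.V.fiber s)) {d : ℕ}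
    (hd : Module.finrank ℚ U = d) {P : ℤ} (hP : P + P = d * k) :
    ∃ m : Fin d → D.VZ.fiber s, (∀ i, D.toRat s (m i) ∈ U) ∧
      {t : S | ∃ γ : Path.Homotopic.Quotient s t, ∃ W : SubHodgeStructure (D.hodge t), W.toSubmodule = U.map (D.V.transport γ)} =
        {t : S | ∃ γ : Path.Homotopic.Quotient s t,
          (D.exteriorPower d).IsHodgeAt t P ((D.exteriorPower d).VZ.transport γ (_root_.exteriorPower.ιMulti ℤ d m))} := by
  obtain ⟨m, hu, hmU⟩ := D.exists_integral_frame s hd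
  exact ⟨m, hmU, D.translateLocus_eq_determinationLocus_exteriorPower_of_finrank_eq s hu hmU hd hP⟩

/-! ## §3 Cor. 1.4 (`dim U = d`, `r = 1`): everything or finite, by Cor. 1.3 for `⋀ᵈ D` -/

variable {V : Type u} [AddCommGroup V] [Module ℚ V] [FiniteDimensional ℚ V]
variable {X : Type*} [TopologicalSpace X] [CompactSpace X]

/-- **Cattani–Deligne–Kaplan, COROLLARY 1.4 for a rational subspace of ANY dimension `d`, `r = 1`, over a PUNCTURED COMPACT CURVE** («reduces us to
the one-dimensional case … and one applies 1.3»): `D : VHSData S k` on a preconnected `S`, `U ⊆ V_{s₀}` rational of dimension `d`, `P + P = d·k`; FOR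
THE EXTERIOR-POWER DATUM `⋀ᵈ D` the hypotheses of the tree's Cor. 1.3 over a punctured compact curve
(`determinationLocus_eq_univ_or_finite_of_compactification`): flat interior period charts with a metric comparison at every point, flat unipotent
puncture charts `Lᵢ, Γᵢ, Λᵢ, σᵢ, eᵢ`, and a compact `X ⊇ j(S)` with disc charts `φ i` centred at the punctures `pt i`, `j (σ i z) = (φ i)⁻¹(e^{2πiz})`.
Then **the locus `{t ∈ S | some flat translate of U to V_t underlies a sub-Hodge structure}` is ALL of `S` or a FINITE set** («is an algebraic
subvariety of `S`»). [cite: CattaniDeligneKaplan1995, Cor. 1.4 and its proof (p. 486), Cor. 1.3 (p. 484), «Proof of 1.5 ⟹ 1.1» (p. 485)]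
[cite: Schmid1973, §2 (cite only)] -/
theorem translateLocus_eq_univ_or_finite_of_compactification [PreconnectedSpace S] {d : ℕ} {P : ℤ} (hP : P + P = d * k) {s₀ : S}
    {U : Submodule ℚ (D.V.fiber s₀)} (hd : Module.finrank ℚ U = d)
    -- flat interior charts for `⋀ᵈ D` at every point
    (hint : ∀ x : S, ∃ ψ : OpenPartialHomeomorph S ℂ, x ∈ ψ.source ∧ IsPreconnected ψ.target ∧
      ∃ (e : ∀ c : ℂ, (D.exteriorPower d).V.fiber (ψ.symm c) ≃ₗ[ℚ] V) (H₀ : HodgeStructure V (d * k)) (P₀ : H₀.Polarization)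
        (h : ℂ → Module.End ℂ (ℂ ⊗[ℚ] V)) (Λ₀ : Submodule ℤ V) (κ : ℝ),
        (∀ (φ : Module.Dual ℂ (ℂ ⊗[ℚ] V)) (w : ℂ ⊗[ℚ] V), AnalyticOnNhd ℂ (fun c => φ (h c w)) ψ.target) ∧
        (∀ c ∈ ψ.target, (((D.exteriorPower d).hodge (ψ.symm c)).F P).map ((e c).toLinearMap.baseChange ℂ) = (H₀.F P).comap (h c)) ∧
        Λ₀.FG ∧ (∀ c ∈ ψ.target, ∀ u : (D.exteriorPower d).VZ.fiber (ψ.symm c), e c ((D.exteriorPower d).toRat (ψ.symm c) u) ∈ Λ₀) ∧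
        0 < κ ∧ (∀ c ∈ ψ.target, ∀ x : (D.exteriorPower d).V.fiber (ψ.symm c),
          κ * P₀.hodgeNorm (ofRat (e c x)) ≤ ((D.exteriorPower d).form (ψ.symm c)).hodgeNorm (ofRat x)) ∧
        (∀ c ∈ ψ.target, ∀ c' ∈ ψ.target, ∃ δ : Path.Homotopic.Quotient (ψ.symm c) (ψ.symm c'),
          ∀ y : (D.exteriorPower d).V.fiber (ψ.symm c), e c' ((D.exteriorPower d).V.transport δ y) = e c y))
    -- flat puncture charts for `⋀ᵈ D`
    {ι : Type*} (L : ι → PolarizedLimitMixedHodgeStructure V (d * k)) (Γ : ι → ℂ → Module.End ℂ (ℂ ⊗[ℚ] V)) (hΓ0 : ∀ i, Γ i 0 = 0)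
    (hΓan : ∀ (i : ι) (φ : Module.Dual ℂ (ℂ ⊗[ℚ] V)) (w : ℂ ⊗[ℚ] V), AnalyticAt ℂ (fun s => φ (Γ i s w)) 0)
    (hΓb : ∀ (i : ι) (s : ℂ), Γ i s ∈ ⨆ ab ∈ {ab : ℤ × ℤ | ab.1 ≤ -1}, (L i).toMixedHodgeStructure.endPiece ab.1 ab.2)
    (Λ : ι → Submodule ℤ V) (hΛ : ∀ i, (Λ i).FG) (hΛT : ∀ i, ∀ u ∈ Λ i, (L i).monodromy u ∈ Λ i)
    (σ : ι → ℂ → S) (e : ∀ (i : ι) (z : ℂ), (D.exteriorPower d).V.fiber (σ i z) ≃ₗ[ℚ] V) (A₀ : ι → ℝ)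
    (hF : ∀ (i : ι) (z : ℂ), A₀ i ≤ z.im → (((D.exteriorPower d).hodge (σ i z)).F P).map ((e i z).toLinearMap.baseChange ℂ) =
      (((L i).F P).map (IsNilpotent.exp (Γ i (Complex.exp (2 * Real.pi * Complex.I * z))))).map (IsNilpotent.exp (z • (L i).N.baseChange ℂ)))
    (hQ : ∀ (i : ι) (z : ℂ), A₀ i ≤ z.im → ∀ x y : (D.exteriorPower d).V.fiber (σ i z),
      ((D.exteriorPower d).form (σ i z)).form x y = (L i).Q (e i z x) (e i z y))
    (hΛ₁ : ∀ (i : ι) (z : ℂ), A₀ i ≤ z.im → ∀ u : (D.exteriorPower d).VZ.fiber (σ i z), e i z ((D.exteriorPower d).toRat (σ i z) u) ∈ Λ i)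
    (hflat : ∀ (i : ι) (z z' : ℂ), A₀ i ≤ z.im → A₀ i ≤ z'.im → ∃ δ : Path.Homotopic.Quotient (σ i z) (σ i z'),
      ∀ y : (D.exteriorPower d).V.fiber (σ i z), e i z' ((D.exteriorPower d).V.transport δ y) = e i z y)
    -- the compactification with disc charts at the punctures
    {j : S → X} (hj : IsEmbedding j) (pt : ι → X) (hpS : ∀ i, pt i ∉ range j) (hcov : ∀ x : X, x ∉ range j → ∃ i, x = pt i)
    (φ : ι → OpenPartialHomeomorph X ℂ) (hp : ∀ i, pt i ∈ (φ i).source) (hφp : ∀ i, φ i (pt i) = 0)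
    (hball : ∀ i, Metric.ball (0 : ℂ) (Real.exp (-(2 * Real.pi * A₀ i))) ⊆ (φ i).target)
    (hσ : ∀ (i : ι) (z : ℂ), A₀ i < z.im → j (σ i z) = (φ i).symm (Complex.exp (2 * Real.pi * Complex.I * z))) :
    {t : S | ∃ γ : Path.Homotopic.Quotient s₀ t, ∃ W : SubHodgeStructure (D.hodge t), W.toSubmodule = U.map (D.V.transport γ)} = univ ∨
      {t : S | ∃ γ : Path.Homotopic.Quotient s₀ t, ∃ W : SubHodgeStructure (D.hodge t), W.toSubmodule = U.map (D.V.transport γ)}.Finite := by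
  obtain ⟨m, hu, hmU⟩ := D.exists_integral_frame s₀ hd
  rw [D.translateLocus_eq_determinationLocus_exteriorPower_of_finrank_eq s₀ hu hmU hd hP]
  exact (D.exteriorPower d).determinationLocus_eq_univ_or_finite_of_compactification hP (_root_.exteriorPower.ιMulti ℤ d m) hint L Γ hΓ0 hΓan
    hΓb Λ hΛ hΛT σ e A₀ hF hQ hΛ₁ hflat hj pt hpS hcov φ hp hφp hball hσ

/-- **Cor. 1.4 (any `d`, `r = 1`) with the abstract open ends ∕ compact core** (the tree's `determinationLocus_eq_univ_or_finite` for `⋀ᵈ D`): the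
translate locus of a `d`-dimensional `U` is ALL of `S` or FINITE. [cite: CattaniDeligneKaplan1995, Cor. 1.4 and its proof (p. 486), Cor. 1.3 (p. 484)]
[cite: Schmid1973, §2 (cite only)] -/
theorem translateLocus_eq_univ_or_finite [PreconnectedSpace S] {d : ℕ} {P : ℤ} (hP : P + P = d * k) {s₀ : S} {U : Submodule ℚ (D.V.fiber s₀)}
    (hd : Module.finrank ℚ U = d)
    -- flat interior charts for `⋀ᵈ D` at every point
    (hint : ∀ x : S, ∃ ψ : OpenPartialHomeomorph S ℂ, x ∈ ψ.source ∧ IsPreconnected ψ.target ∧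
      ∃ (e : ∀ c : ℂ, (D.exteriorPower d).V.fiber (ψ.symm c) ≃ₗ[ℚ] V) (H₀ : HodgeStructure V (d * k)) (P₀ : H₀.Polarization)
        (h : ℂ → Module.End ℂ (ℂ ⊗[ℚ] V)) (Λ₀ : Submodule ℤ V) (κ : ℝ),
        (∀ (φ : Module.Dual ℂ (ℂ ⊗[ℚ] V)) (w : ℂ ⊗[ℚ] V), AnalyticOnNhd ℂ (fun c => φ (h c w)) ψ.target) ∧
        (∀ c ∈ ψ.target, (((D.exteriorPower d).hodge (ψ.symm c)).F P).map ((e c).toLinearMap.baseChange ℂ) = (H₀.F P).comap (h c)) ∧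
        Λ₀.FG ∧ (∀ c ∈ ψ.target, ∀ u : (D.exteriorPower d).VZ.fiber (ψ.symm c), e c ((D.exteriorPower d).toRat (ψ.symm c) u) ∈ Λ₀) ∧
        0 < κ ∧ (∀ c ∈ ψ.target, ∀ x : (D.exteriorPower d).V.fiber (ψ.symm c),
          κ * P₀.hodgeNorm (ofRat (e c x)) ≤ ((D.exteriorPower d).form (ψ.symm c)).hodgeNorm (ofRat x)) ∧
        (∀ c ∈ ψ.target, ∀ c' ∈ ψ.target, ∃ δ : Path.Homotopic.Quotient (ψ.symm c) (ψ.symm c'),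
          ∀ y : (D.exteriorPower d).V.fiber (ψ.symm c), e c' ((D.exteriorPower d).V.transport δ y) = e c y))
    -- flat puncture charts for `⋀ᵈ D`
    {ι : Type*} (L : ι → PolarizedLimitMixedHodgeStructure V (d * k)) (Γ : ι → ℂ → Module.End ℂ (ℂ ⊗[ℚ] V)) (hΓ0 : ∀ i, Γ i 0 = 0)
    (hΓan : ∀ (i : ι) (φ : Module.Dual ℂ (ℂ ⊗[ℚ] V)) (w : ℂ ⊗[ℚ] V), AnalyticAt ℂ (fun s => φ (Γ i s w)) 0)
    (hΓb : ∀ (i : ι) (s : ℂ), Γ i s ∈ ⨆ ab ∈ {ab : ℤ × ℤ | ab.1 ≤ -1}, (L i).toMixedHodgeStructure.endPiece ab.1 ab.2)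
    (Λ : ι → Submodule ℤ V) (hΛ : ∀ i, (Λ i).FG) (hΛT : ∀ i, ∀ u ∈ Λ i, (L i).monodromy u ∈ Λ i)
    (σ : ι → ℂ → S) (e : ∀ (i : ι) (z : ℂ), (D.exteriorPower d).V.fiber (σ i z) ≃ₗ[ℚ] V) (A₀ : ι → ℝ)
    (hF : ∀ (i : ι) (z : ℂ), A₀ i ≤ z.im → (((D.exteriorPower d).hodge (σ i z)).F P).map ((e i z).toLinearMap.baseChange ℂ) =
      (((L i).F P).map (IsNilpotent.exp (Γ i (Complex.exp (2 * Real.pi * Complex.I * z))))).map (IsNilpotent.exp (z • (L i).N.baseChange ℂ)))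
    (hQ : ∀ (i : ι) (z : ℂ), A₀ i ≤ z.im → ∀ x y : (D.exteriorPower d).V.fiber (σ i z),
      ((D.exteriorPower d).form (σ i z)).form x y = (L i).Q (e i z x) (e i z y))
    (hΛ₁ : ∀ (i : ι) (z : ℂ), A₀ i ≤ z.im → ∀ u : (D.exteriorPower d).VZ.fiber (σ i z), e i z ((D.exteriorPower d).toRat (σ i z) u) ∈ Λ i)
    (hflat : ∀ (i : ι) (z z' : ℂ), A₀ i ≤ z.im → A₀ i ≤ z'.im → ∃ δ : Path.Homotopic.Quotient (σ i z) (σ i z'),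
      ∀ y : (D.exteriorPower d).V.fiber (σ i z), e i z' ((D.exteriorPower d).V.transport δ y) = e i z y)
    (hopen : ∀ (i : ι) (A : ℝ), A₀ i ≤ A → IsOpen (σ i '' {z : ℂ | A < z.im}))
    (hcore : ∀ A : ι → ℝ, (∀ i, A₀ i ≤ A i) → ∃ C : Set S, IsCompact C ∧ C ∪ ⋃ i, σ i '' {z : ℂ | A i < z.im} = univ) :
    {t : S | ∃ γ : Path.Homotopic.Quotient s₀ t, ∃ W : SubHodgeStructure (D.hodge t), W.toSubmodule = U.map (D.V.transport γ)} = univ ∨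
      {t : S | ∃ γ : Path.Homotopic.Quotient s₀ t, ∃ W : SubHodgeStructure (D.hodge t), W.toSubmodule = U.map (D.V.transport γ)}.Finite := by
  obtain ⟨m, hu, hmU⟩ := D.exists_integral_frame s₀ hd
  rw [D.translateLocus_eq_determinationLocus_exteriorPower_of_finrank_eq s₀ hu hmU hd hP]
  exact (D.exteriorPower d).determinationLocus_eq_univ_or_finite hP (_root_.exteriorPower.ιMulti ℤ d m) hint L Γ hΓ0 hΓan hΓb Λ hΛ hΛT σ e A₀
    hF hQ hΛ₁ hflat hopen hcore

/-- **Read-off**: when the Cor-1.4 alternative holds and the locus is infinite, SOME flat translate of `U` to EVERY fibre `V_t` underlies a sub-Hodge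
structure. [cite: CattaniDeligneKaplan1995, Cor. 1.4 (p. 486)] -/
theorem forall_exists_subHodgeStructure_translate_of_infinite {s₀ : S} {U : Submodule ℚ (D.V.fiber s₀)}
    (h : {t : S | ∃ γ : Path.Homotopic.Quotient s₀ t, ∃ W : SubHodgeStructure (D.hodge t), W.toSubmodule = U.map (D.V.transport γ)} = univ ∨
      {t : S | ∃ γ : Path.Homotopic.Quotient s₀ t, ∃ W : SubHodgeStructure (D.hodge t), W.toSubmodule = U.map (D.V.transport γ)}.Finite)
    (hinf : {t : S | ∃ γ : Path.Homotopic.Quotient s₀ t, ∃ W : SubHodgeStructure (D.hodge t),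
      W.toSubmodule = U.map (D.V.transport γ)}.Infinite) (t : S) :
    ∃ γ : Path.Homotopic.Quotient s₀ t, ∃ W : SubHodgeStructure (D.hodge t), W.toSubmodule = U.map (D.V.transport γ) := by
  have ht : t ∈ {t : S | ∃ γ : Path.Homotopic.Quotient s₀ t, ∃ W : SubHodgeStructure (D.hodge t),
      W.toSubmodule = U.map (D.V.transport γ)} := by
    rw [h.resolve_right hinf]; exact mem_univ t
  exact ht

end Motives.VHSData

end Literature.AlgebraicGeometry

end
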